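import Mathlib
import HarnessLib
import HarnessLib.Audit
import Summits.AtomisticToContinuum.Statement

/-!
Route: JOddEnslaving

CLOSED (retired) 2026-08-15T13:43:27Z by operator:999:1257524 — reason: not-a-thesis: assembly does not conclude the sub-problem Statement — note: D-0027 §2.1 audit (human 2026-08-15: routes that do not decide the summit are removed): the assembly concludes `Literature.MathematicalPhysics.KineticTheory.HydrodynamicLimit`, not the sub-problem statement; a NEW conforming route may be opened from the same idea (generated `closes : … → _root_.Hydr. The file is kept as the record of this route; refuted decls are indexed as negative knowledge (`ledger negatives`).

# Route JOddEnslaving — enslave the J-odd contact correlation — only the anti-Boltzmann flux can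
beat Boltzmann, and it is capped at κ<1 of the production

It suffices to show X = OddFluxEfficiency ∧ EvenFluxEnskog ∧ RateFloor ∧ LocalSecondLaw ∧ DensityCap
(cards j-odd-contact-correlation-h-split = spine,
and its merged twin collision-fluctuation-relation-anti-boltzmann-flux). KINETIC HALF (new): the
one-body entropy production of the TRUE gas, read
off the empirical collision measure of one hard-sphere trajectory, splits EXACTLY (ParitySplit) into
a J-even Boltzmann–Enskog production
K[F(1−e^{−F})] = ∫γ_s(hh_*−h′h_*′)F ≥ 0 and the anti-Boltzmann flux K[F(1+e^{−F})] =
∫γ_a(hh_*+h′h_*′)F carried ONLY by the part γ_a of the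
pre-collisional contact correlation that is odd under the inverse collision J(v,v_*,ω) =
(v′,v_*′,−ω) (F = one-body surprisal jump of a
collision). OddFluxEfficiency: the odd flux never undoes more than a fraction κ < 1 of the even
production (uniformly below a reduced-density
ceiling). With collisional balance (free at fixed density, ν_N ≍ N^{1/3}) and RateFloor this forces
the limit local velocity law to be
Maxwellian (ParityRigidity) — no molecular chaos, no classification of stationary states,
correlations of any size pass if J-even.
CONFIGURATIONAL HALF: EvenFluxEnskog (the two J-even collisional-transfer marks have Enskog
statistics with the thermodynamic contact value).
HYGIENE shared verbatim with route CollisionMeasureChaos: LocalSecondLaw, DensityCap; then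
compactness + free balance + weak–strong uniqueness.
Lean: `OddFluxEfficiency ∧ EvenFluxEnskog ∧ RateFloor ∧ LocalSecondLaw ∧ DensityCap`

## Assembly
Standard reductions, as in CollisionMeasureChaos with ContactChaos/CollisionRate replaced: (i)
tightness of (μ^N, κ^N) from energy conservation + CollisionTightness, random subsequential limits
(μ̄, κ̄); (ii) EmpiricalEnskogIdentity ÷ ν_N ⇒ collisional balance of κ̄_{t,x} for all admissible φ,
in particular κ̄[F̄_ϑ] = 0 for φ = log h̄_ϑ(t,x,·); (iii) the pointwise identity F = ½F(1−e^{−F}) +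
½F(1+e^{−F}) and OddFluxEfficiency passed to the limit give (1−κ)·κ̄[F̄_ϑ(1−e^{−F̄_ϑ})] ≤ 2η(ϑ) → 0;
RateFloor bounds this from below by g₀σ³ × the ideal even production, so ParityRigidity makes
μ̄_{t,x} a point mass or Maxwellian, and LocalSecondLaw kills point masses (θ → 0 makes −H → −∞);
DensityCap keeps σ³ρ̄ < η₀ (cutoffs inactive) and forbids spatial concentration in the r → 0
passage; (iv) with Maxwellian μ̄ and the identity tested on c ∈ {1, v, |v|²/2}, EvenFluxEnskog
identifies the transfer terms: the limit fields solve the complete hs-Euler system weakly with p =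
hsPressure (HsEosLowDensity for smoothness), and LocalSecondLaw makes them admissible; (v)
relative-energy weak–strong uniqueness for the complete Euler system (BrezinaFeireisl2018,
FeireislNovotny2012, Dafermos1979) identifies every limit with the classical solution on [0,T), so
the full sequence converges in probability: HydrodynamicLimit (σ₀ = min over the five items').

Rationale: WHY THIS LINE. Boltzmann's H-theorem needs micro-reversibility of the kernel, not factorisation
(CIP1994 §3.2, tree `IsGradCutoffKernel.collide_neg`,
`entropyProduction_nonneg`): writing the true contact law as γ·((v−v_*)·ω)₊hh_* and splitting γ =
γ_s + γ_a under J shows that every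
J-even chaos violation (Enskog's χ[n], Resibois1978's H-theorem, any γ(|g|,|g·ω|,v+v_*), everything
MD has measured, Lutsko1996) merely
RESCALES Boltzmann's production, and that the odd part is the sole carrier of obstruction; the
identities are γ-free in event form
(K[F(1±e^{−F})]), so the whole kinetic half of the Boltzmann hypothesis becomes ONE one-sided
inequality between two empirical collision sums
— a fluctuation-relation reading of the Stosszahlansatz (merged card; Bouchet-type FR structure
doi:10.1007/s10955-020-02588-y holds per
collision exactly iff γ_a = 0). Imported: kinetic theory of dense gases (VanbeijerenErnst1973,
Dorfman1999 ring operator: γ_a = O(φ)·𝓛_a[h/M−1]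
at first order, the foreseen first child of crux 2), hyperbolic PDE (relative-energy weak–strong
uniqueness, BrezinaFeireisl2018, Dafermos1979)
for the assembly. Versus the negatives index (empty) and sibling CollisionMeasureChaos: its crux
ContactChaos (stmt-3987) demands PRODUCT
structure of the limit contact kernel for all marks; here arbitrary J-even correlations are allowed
and only a signed scalar functional is
bounded — a strictly weaker kinetic input, paid for by making the configurational input explicit
(EvenFluxEnskog) instead of hiding it in
product structure × rate. The card's triage audit (refuter-triage-18) left two gaps, both assigned
here: (1) "h = M says nothing about γ_s;
a J-even velocity-dependent γ_s shifts the collisional stress" is exactly crux EvenFluxEnskog; (2)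
the Enskog offset (partner at x_i − εn̂) rides
inside the r-mollified empirical law and is O(ε/r) → 0 as N → ∞ at fixed r, which is why the
statements take N → ∞ before r, ϑ → 0.

RANKED CRUXES. #2 OddFluxEfficiency (crux) — COLLISIONAL EFFICIENCY / J-ENSLAVING (card K1; merged
card (IV)), finite-N empirical form. ∃ η₀ > 0, κ < 1: for σ < σ₀(profiles), local Gibbs data, any
flows Φ_N, horizon τ, continuous weight χ ≥ 0 on [0,τ]×𝕋³ and density cutoff g ≥ 0 vanishing on
[η₀,∞): let h = h^N_{r,ϑ}(s,x,·) be the empirical one-particle law mollified at space scale r (cone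
kernel) and velocity scale ϑ (Gaussian), F = log[h(v⁻)h(v_*⁻)/(h(v⁺)h(v_*⁺))] the one-body surprisal
jump of a collision (pre-velocities by reflectVel, h frozen at x_i), K_N[m] = (ε/(N+1)) Σ_{collision
times ≤ τ} Σ_{ordered contact pairs} m; then P( K_N[χ g F(1+e^{−F})] + κ·K_N[χ g F(1−e^{−F})] < −η )
≤ δ for r, ϑ < r₀(η,δ) and N ≥ N₀(r,ϑ). By ParitySplit the first sum is the J-ODD channel
∫γ_a(hh_*+h′h_*′)F (≡ 0 for every J-even contact correlation), the second the J-even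
Boltzmann–Enskog production ∫γ_s(hh_*−h′h_*′)F ≥ 0. [difficulty: open-problem] (why it might fail:
ring/recollision memory may feed γ_a at an order not slaved to the instantaneous imbalance
(transient κ(t)→1, kinetic arrest in dense pockets), or the ϑ-smoothing artefact may not vanish
uniformly in N; the MD null |κ|<0.02 (φ≤0.4) covers homogeneous relaxation only.) [CIP1994,
Resibois1978, Lutsko1996, VanbeijerenErnst1973, Dorfman1999, OllaVaradhanYau1993]
#3 EvenFluxEnskog (crux) — CONFIGURATIONAL HALF in flux form (card "(K ⇒ Gibbs)"; CollisionRate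
stmt-3988 for the two transfer marks instead of Ψ = 1, no product structure). ∃ η₀ > 0: for σ <
σ₀(profiles), every τ, continuous χ, continuous cutoff g vanishing on [η₀,∞), the J-EVEN
collisional-transfer marks — momentum Ξ_P^{kl}(n̂,v,w) = ((w−v)·n̂)₊ n̂_k n̂_l (= jump of v_k times
n̂_l) and energy Ξ_E^k = ((w−v)·n̂)₊ (n̂·(v+w)/2) n̂_k — evaluated at (ε⁻¹(x_i−x_j), v_i⁻, v_j⁻)
satisfy K_N[χ g(σ³ρ_r) Ξ] − σ³ ∫₀^τ∫ χ g(σ³ρ_r) Y(σ³ρ_r) B^Ξ_r dx ds → 0 in probability (N → ∞ then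
r → 0), with Y(η) = (3/2π)·deriv hsExcessFreeEnergy η the thermodynamic contact value, B^Ξ_r the
r-mollified ∫∫Θ_Ξ dμ^N dμ^N near x and Θ_Ξ(v,w) = ∫Ξ(ω,v,w)((w−v)·ω)₊dω. At a Maxwellian local law
the odd correlation drops out of these fluxes (marks J-even, MM_* dλ J-invariant); this item pins
the even part to Enskog's value, giving p = hsPressure (kinetic ρθ + transfer (2π/3)σ³Yρ²θ) and the
energy flux (E+p)u. [difficulty: open-problem] (why it might fail: even (J-symmetric)
velocity-dependent contact structure at a Maxwellian one-particle state — |g|-dependent approach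
rates from rings, shear-induced contact anisotropy at finite Kn (Lutsko1996) — is invisible to every
entropy functional and would shift p away from ρθZ(ρσ³).) [VanbeijerenErnst1973, Resibois1978,
Lutsko1996, Ruelle1969, LebowitzPenrose1964, Bogolyubov1975]
#4 RateFloor (crux) — NO COLLISION AVOIDANCE (merged card clause G_s ≥ g₀). ∃ g₀ > 0: for σ <
σ₀(profiles), every τ, continuous χ ≥ 0 and every bounded continuous mark Ξ ≥ 0 of (n̂, v⁻, v_*⁻):
P( K_N[χ Ξ] < g₀ σ³ ∫₀^τ∫ χ B^Ξ_r dx ds − η ) ≤ δ for r < r₀, N ≥ N₀(r). In the limit: κ̄ ≥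
g₀σ³((w−v)·n̂)₊ dn̂ μ̄⊗μ̄ — every pair of locally present velocities collides at every impact
geometry at rate ≥ g₀ × ideal-gas rate (Enskog predicts γ ≥ Y ≥ 1). Supplies the thickness of the
limit contact law that ParityRigidity consumes; no density cutoff (crowding raises rates).
[difficulty: L] (why it might fail: dynamical screening could suppress approach rates of slow pairs
(|g| → 0) or of shadowed geometries below any UNIFORM multiple of the ideal rate; a
velocity-dependent floor g₀(|g|,n̂) would still serve but is not what is filed.)
[VanbeijerenErnst1973, Resibois1978, PulvirentiSimonellaTrushechkin2018, GST2013]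
#5 LocalSecondLaw (crux) — (shared verbatim with CollisionMeasureChaos,
stmt-AtomisticToContinuum-3989) LOCAL ENTROPY INEQUALITY IN PROBABILITY for the r-mollified
empirical fields (ρ, m, e)^N_r with θ = (2/3)(e/ρ − |m|²/2ρ²) and H(ρ,θ) = −ρ(3/2 log θ − log ρ −
hsExcessFreeEnergy(ρσ³)): for every smooth φ ≥ 0 supported in [0,τ) × 𝕋³, P(∫∫ H (∂_sφ + (m/ρ)·∇φ)
dx ds + ∫ H(ρ(0),θ(0)) φ(0) dx < −η) → 0 as N → ∞ then r → 0, under the conjunct's hypotheses — the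
admissibility the relative-energy method consumes for the COMPLETE Euler system; the kinetic H-split
gives only the one-particle (kinetic) entropy, the configurational −f_ex part is this item's
business. Also excludes zero-temperature (point-mass) limit laws left open by ParityRigidity.
[difficulty: open-problem] (why it might fail: at Euler scaling the leading production vanishes by
free balance and the local sign is that of the O(Kn) deviation (Navier–Stokes-order dissipation,
incl. the configurational entropy current); no in-probability local second law is known for
deterministic spheres.) [FeireislNovotny2012, BrezinaFeireisl2018, Resibois1978,
OllaVaradhanYau1993, Spohn1991]
#6 DensityCap (crux) — (shared verbatim with CollisionMeasureChaos, stmt-AtomisticToContinuum-3990)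
NO OVERCOMPRESSION BEFORE THE SHOCK: under the conjunct's hypotheses, for every t < T and η > 0, P(∃
s ≤ t, ∃ x: ρ^N_r(s,x) > ρ(s,x) + η) → 0 as N → ∞ then r → 0 (ρ the classical Euler density). Needed
twice here: it keeps the cutoffs g of OddFluxEfficiency / EvenFluxEnskog inactive before T (κ and Y
are only claimed below η₀), and it rules out spatial concentration of mass when passing r → 0 to the
local laws μ̄_{t,x}. [difficulty: L] (why it might fail: transient mesoscopic pre-crystalline
clusters ahead of steepening compressive waves; there is no maximum principle for the empirical
density of the particle system, and for implosion-type data the Euler density itself leaves the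
fluid branch near T.) [Spohn1991, OllaVaradhanYau1993, Ruelle1969]
#9 ParitySplit (support) — THE H-SPLIT IN EVENT FORM (cards P1; provable now). For a measurable
contact kernel K(v,v_*,ω) (= γ × hard-sphere rate), h > 0 and F = log(hh_*/h′h_*′), with K_s, K_a
the J-even/odd parts (J = (collide, −ω), measure-preserving: tree
`measurePreserving_collideSwap_prod`, `measurePreserving_swap_negDir`) and two integrability side
conditions: ∫K hh_* F(1−e^{−F}) = ∫K_s(hh_*−h′h_*′)F = 4·entropyProduction K_s h (≥ 0 for K ≥ 0 by
`entropyProduction_nonneg`) and ∫K hh_* F(1+e^{−F}) = ∫K_a(hh_*+h′h_*′)F — so the odd event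
statistic vanishes for every J-even K (Enskog, any position-only or |g|,|g·ω|-dependent structure)
and adding the two gives σ = ½∫K hh_* F = ¼∫K_sAF + ¼∫K_aBF. [difficulty: provable-now] [CIP1994,
Villani2002, Resibois1978]
#9 ParityRigidity (support) — VANISHING EVEN PRODUCTION IS RIGID (velocity space; replaces
BalanceRigidity stmt-3992 for this route). For a probability measure m on ℝ³ with finite second
moment, h_ϑ = m ∗ Gaussian_ϑ and F_ϑ(ω,v,w) = log[h_ϑ(v)h_ϑ(w)/(h_ϑ(v′)h_ϑ(w′))]: if the even
production against the ideal contact law, ∫∫∫((w−v)·ω)₊ F_ϑ(1−e^{−F_ϑ}) dω m(dv)m(dw) (a lower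
integral, +∞ allowed), tends to 0 as ϑ → 0⁺, then m is a point mass or a Maxwellian law. Proof
sketch: singular m makes the integral blow up (collisions knock mass off the support); absolutely
continuous m gives, by Fatou, (hh_*−h′h_*′)log(hh_*/h′h_*′) = 0 a.e., so log h is a continuous
collision invariant (tree `IsCollisionInvariant.exists_eq_quadratic_holds`,
`integral_collisionOp_mul_log_eq_zero_iff_holds`). [difficulty: M] [CIP1994, Villani2002,
LuMouhot2015, DesvillettesVillani2005]
#9 CollisionTightness (support) — (shared verbatim, stmt-AtomisticToContinuum-3991) tightness of the
normalised collision count: for σ < σ₀(profiles), every τ and δ there are K, N₀ with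
P((ε/(N+1))·#collisions in [0,τ] > K) ≤ δ for N ≥ N₀ — makes K_N[·] tight; needed with moment
control to pass the unbounded surprisal marks of OddFluxEfficiency to the limit. [difficulty: M]
[PulvirentiSimonellaTrushechkin2018, GST2013, Spohn1991]
#9 EmpiricalEnskogIdentity (support) — (shared verbatim, stmt-AtomisticToContinuum-3993) the exact
Bogolyubov / microscopic-Enskog identity for empirical measures along one hard-sphere trajectory on
𝕋³ (free transport of ⟨μ_s, b c⟩ = collision sum of b(x_i)[c(v_i) − c(v_i⁻)]); divided by ν_N ≍
N^{1/3} it gives COLLISIONAL BALANCE of the limit contact law for free (∫(φ′+φ_*′−φ−φ_*)dκ̄ = 0,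
hence κ̄[F] = 0 with φ = log h̄_ϑ), and with b = χ, c ∈ {1, v, |v|²/2} the conservation laws whose
transfer terms are the EvenFluxEnskog marks. [difficulty: provable-now] [Bogolyubov1975,
PulvirentiSimonellaTrushechkin2018, GST2013]
#9 HsEosLowDensity (support) — (shared verbatim, stmt-AtomisticToContinuum-0768) hard-sphere
equation of state at low density: f_ex analytic on (−η₀, η₀), F(0) = 0, F′(0) = 2π/3, canonical
thermodynamic limit exists — makes Y = (3/2π)f_ex′ and hsPressure smooth (hyperbolicity, weak–strong
uniqueness, contact value). [difficulty: M] [Ruelle1969, LebowitzPenrose1964]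

TWO-LAYER PLAN. OddFluxEfficiency ⇐ FirstOrderEnslaving → NonlinearSlaving → OddFluxEfficiency:
FirstOrderEnslaving = card K2 (the J-odd projection of the
zero-frequency three-body / ring operator of VanbeijerenErnst1973–Dorfman1999 Ch. 18 is bounded
relative to the linearised hard-sphere operator
off the collision invariants, κ = O(φ)·‖𝓛_a‖/gap; needs two definition items first),
NonlinearSlaving = the finite-N forward statement given the
linear one. EvenFluxEnskog ⇐ StaticContactValue (YBG/BGY rigidity at Maxwellian velocities, card
ybg-hard-core-rigidity) → DynamicEvenness →
EvenFluxEnskog. ParityRigidity ⇐ absolutely-continuous case → singular case (k ≤ 3, depth 1 each).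
Nothing filed now.

KILL CRITERIA. ¬OddFluxEfficiency with a witness family of forward local-Gibbs evolutions where the
anti-Boltzmann flux cancels a fixed fraction → 1 of the
production (kinetic arrest at arbitrarily small σ) closes the route outright (close --reason
refuted:OddFluxEfficiency) and grades the merged
card's conjecture (IV) false; a regular TI stationary non-Gibbs state of 3-D hard spheres with
non-Maxwellian velocities kills this route AND
RelEntropyErgodic/CollisionMeasureChaos. ¬EvenFluxEnskog alone ⇒ pivot: keep the kinetic half,
re-dock the configurational half onto
ybg-hard-core-rigidity / LdDrudeFluxGibbsianity items. ¬RateFloor by slow-pair screening ⇒ restate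
with a |g|-weighted floor (ParityRigidity
survives with any a.e.-positive floor). ¬LocalSecondLaw / ¬DensityCap are shared hazards (pivot with
CollisionMeasureChaos to the Lions
dissipative variant / pre-compression horizon). ContactChaos (stmt-3987) PROVED elsewhere moots
cruxes 2 and 4 (product structure ⇒ γ_a = 0,
floor = rate) but not 3.

NOT DECOMPOSED YET. Uniform integrability of the unbounded surprisal marks F(1±e^{−F}) against κ^N
(cubic velocity moments at collisions — shared with
AprioriTailsRattlers / stmt-0781; HighMomentumCutoff in its mildest, time-integrated form); the r →
0 / ϑ → 0 bookkeeping (Lebesgue points in x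
before deconvolution in v: the two scales are deliberately independent in OddFluxEfficiency);
measurability of the collision functionals
(finsum over collisionTimes is finite on Φ.good); the density argument feeding φ = log h̄_ϑ(t,x,·)
into the balance identity; the ε-expansion
b(x_i) − b(x_j) = ε n̂·∇b + O(ε²) turning collision sums into the transfer marks; constants η₀, κ,
g₀. All are layer-2 children or prover-side
lemmas (`--supports`), to be filed only after a crux moves.

CHEAPEST FALSIFIER. Run the merged card's estimator on data the conjunct uses: event-driven MD, N ≈
2·10³, equilibrium positions × INHOMOGENEOUS local-Gibbs
velocities (shear or temperature wave), φ ∈ {0.05, 0.2, 0.4}; per collision the surprisal jump F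
from the running (r,ϑ)-mollified empirical
law; Ξ = ⟨F(1+e^{−F})⟩ (odd), P = ⟨F(1−e^{−F})⟩ (even), DSMC control through the same pipeline. κ̂ =
−Ξ/P → 1 at late times (P down two
decades) or in sheared cells KILLS crux 2; Ξ ≠ 0 under DSMC exposes the ϑ-smoothing bias the
quantifier order absorbs. The HOMOGENEOUS version
was run by the merged card's author (EDMD, N = 256, 3·10⁵ collisions/density): |κ̂_w| < 0.02 at 95%
CL for φ ≤ 0.4, DSMC 0.019 ± 0.017 —
margin ≈ 50; the inhomogeneous/late-time protocol is NOT run (no kit in plancard mode). Lookup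
falsifier for crux 3: a published MD contact
value in a non-equilibrium Maxwellian-velocity state off Carnahan–Starling Y beyond O(Kn)
(Lutsko1996: shear-rate dependent g(σ;ĝ) at
finite Kn — consistent so far).

NUMBERS. ν_N ≍ (N+1)^{1/3}σ² collisions per particle per unit macroscopic time; K_N normalisation
ε/(N+1) makes K_N[1] → σ³Y(ρσ³)π∫∫|v−w|μ̄μ̄ = O(σ³).
Enskog: γ = Y(η) = (Z−1)/((2π/3)η) = 1 + (5π/12)η + O(η²) ≥ 1 (so any g₀ < 1 is predicted safe);
first-order enslaving κ = O(φ) (card K2,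
VanbeijerenErnst1973); measured |κ_w| < 0.02 for φ = 0.05–0.40 (merged card, homogeneous relaxation,
N = 256). Freezing at packing fraction
0.494 (η = ρσ³ ≈ 0.943) bounds any sensible η₀. Items at open: 11 (5 cruxes, 5 supports, 1
assembly); 5 of them shared with CollisionMeasureChaos.

DEFINITION REQUESTS. None needed at open: the γ-free event form states everything over
hardSphereKernel, collide/reflectVel, sphereMeasure, localMaxwellian,
empiricalMeasure, collisionTimes, HardSphereFlow, localGibbsLaw, entropyProduction. Foreseen (layer
2, with FirstOrderEnslaving): `--kind
definition --notion ZeroFrequencyRingOperator --topic Literature/MathematicalPhysics/KineticTheory`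
(linearised three-body/ring collision operator of
hard spheres, VanbeijerenErnst1973 / Dorfman1999 Ch. 18) and `--notion PreCollisionalContactFactor`
(trace of f₂ on the incoming contact set ÷
h⊗h·((v−v_*)·ω)₊, cards' D1) — not filed now.

Novelty: Searches (2026-08-15): `lit search --hybrid "pre-collisional velocity correlations hard spheres
molecular chaos H-theorem Enskog"` (12 held docs:
CIP1994 pp. 29–39, Dorfman1999, Soto2016 §4, Hoover1999, Luscombe2024 — standard H-theorem / Enskog
material, no parity object); `lit vsearch` of the
H-split sentence (8: RezakhanlouVillani2008 pp. 2–28, Gaspard2022, LeBellac2004 — entropy-production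
bounds under chaos only); `lit frontier
AtomisticToContinuum --since 2021` (30 rows: Bose gas, DHM Boltzmann–Grad expositions
arXiv:2602.04407, deterministic heat equation
doi:10.1007/s00222-026-01429-1 — nothing on contact correlations at fixed density); crossref
"H-theorem correlated collisions microscopic reversibility
collision kernel parity odd" (10, irrelevant: molecular micro-reversibility Kaplan–Levine–Manz 1976,
FR Monnai 2005); crossref "velocity correlations
dense hard sphere fluid Enskog pressure collisional transfer NEMD" (10: Erpenbeck 1984, Frezzotti
1998 shock profiles MD vs Enskog — even-statistics
validations); `lit galaxy search "violation of molecular chaos hard spheres" --star all` (0) and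
`"molecular chaos" --star all` (21 noise rows);
openalex/S2/arXiv rate-limited (logged); the two cards' own search logs (Résibois/Piasecki/Bubert
RET H-theorems, Lutsko 1996/2001, SPM 2001,
Bouchet 2020, Spohn 2001) re-read; all 39 sibling Theses grepped for parity/J-odd/enslaving (0) and
CollisionMeasureChaos, RelEntropyErgodic,
DissipativeWeakStrong read in full; `ledger negativ  [refs: 10.1007/s00222-026-01429-1, 10.1007/s10955-020-02588-y, 10.1103/3jnf-mw6y, 2602.04407, doi:10.1007/s00222-026-01429-1, doi:10.1007/s10955-020-02588-y, doi:10.1103/3jnf-mw6y, CIP1994, Dorfman1999, Soto2016, RezakhanlouVillani2008, Gaspard2022, Villani2002, Resibois1978, Lutsko1996]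

Barriers (technique_class: parity-identity, entropy-inequality, collision-measure): - technique_class: parity-identity, entropy-inequality, collision-measure
- Literature.Barriers.AtomisticToContinuum.BoltzmannHypothesisBarrier: evaded in technique class —
nothing is classified: no "stationary + TI + regular ⇒ Gibbs" step, no infinite-volume object; the
kinetic currents are closed by an identity plus OddFluxEfficiency on forward evolutions, the
collisional ones by EvenFluxEnskog; its formal kernel (ideal gas: every velocity law stationary) is
respected exactly — without collisions RateFloor fails and ParityRigidity is vacuous, as it must be.
- Literature.Barriers.AtomisticToContinuum.BoltzmannHypothesisBarrierNarrow: the flux-level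
one-block input it isolates is precisely what cruxes 2–4 replace by typed finite-N statements; scope
caveat (b) (absence of proof, not impossibility) is the bet.
- Literature.Barriers.AtomisticToContinuum.VelocityReversalBarrier: respected — every item is a
statement about LAWS (local Gibbs data, in probability) on forward evolutions; the odd flux is
exactly the reversal-odd object (Loschmidt data have κ > 1), so no sure/pathwise H-theorem is
claimed.
- Literature.Barriers.AtomisticToContinuum.VelocityReversalBarrierNarrow: forward-propagated
one-sided classes are what it explicitly leaves open; used, not fought.
- Literature.Barriers.AtomisticToContinuum.NoDensityExpansionBarrier: not met at open — κ(η₀) < 1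
and g₀ are bounds, nothing is expanded in density; the foreseen child FirstOrderEnslaving uses only
the zero-frequency Navi

Novelty grade: variant — ROUTE REVIEW (refuter, 2026-08-15; route already CLOSED(retired) 13:43Z by operator D-0027 §2.1 — assembly concluded Literature…HydrodynamicLimit instead of _root_.HydrodynamicLimit; a conforming re-filing is allowed, so this note is for it). OBJECTION on crux r2 (8224 OddFluxEfficiency; derivation  (refuter refuter-rreview-route-AtomisticToContinu-4a1d4216-0, 2026-08-15T14:03:17Z; prior: Spohn1991 Part I Ch.3 (local equilibrium decomposition of the Euler limit), OllaVaradhanYau1993 §1 (local equilibrium + flux identification + relative entropy; with noise), CIP1994 §3.2 / Villani2002 Ch.1 §2.4 (H-theorem via micro-reversibility: the parity identity's engine), Resibois1978 (H-theorem for revised Enskog = J-even case), BrezinaFeireisl2018 / FeireislNovotny2012 (complete-Euler weak–s)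

History (route lifecycle, newest last):
- 2026-08-15T13:43:27Z · CLOSED retired — not-a-thesis: assembly does not conclude the sub-problem Statement (operator:999:1257524)

sub-problem: HydrodynamicLimit · status: closed(retired) · opened planner-plancard-AtomisticToContinuum-Hydrody-ff0b9998-0 2026-08-15T12:34:54Z · rev 0 · ledger route-AtomisticToContinuum-JOddEnslaving
GENERATED by the gate from the ledger (D-0016/17). Provers cite these decls: `theorem foo : Summit.AtomisticToContinuum.HydrodynamicLimit.Theses.JOddEnslaving.<Decl> := …` in Summits/AtomisticToContinuum/HydrodynamicLimit/Theorems/<Name>.lean.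
-/

namespace Summit.AtomisticToContinuum.HydrodynamicLimit.Theses.JOddEnslaving

open scoped BigOperators Topology Manifold Classical MeasureTheory ProbabilityTheory Matrix InnerProductSpace ComplexConjugate ContinuousMap
open Filter Set Function TopologicalSpace MeasureTheory

attribute [summit_statement] _root_.HydrodynamicLimit

/-- item stmt-AtomisticToContinuum-8224 · crux · rank 2 · closed · moot by None · by planner
why it might fail: ring/recollision memory may feed γ_a at an order not slaved to the instantaneous imbalance (transient κ(t)→1, kinetic arrest in dense pockets), or the ϑ-smoothing artefact may not vanish uniformly in N; the MD null |κ|<0.02 (φ≤0.4) covers homogeneous relaxation only.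
sources: CIP1994, Resibois1978, Lutsko1996, VanbeijerenErnst1973, Dorfman1999, OllaVaradhanYau1993
[crux] COLLISIONAL EFFICIENCY / J-ENSLAVING (card K1; merged card (IV)), finite-N empirical form. ∃
η₀ > 0, κ < 1: for σ < σ₀(profiles), local Gibbs data, any flows Φ_N, horizon τ, continuous weight χ
≥ 0 on [0,τ]×𝕋³ and density cutoff g ≥ 0 vanishing on [η₀,∞): let h = h^N_{r,ϑ}(s,x,·) be the
empirical one-particle law mollified at space scale r (cone kernel) and velocity scale ϑ (Gaussian),
F = log[h(v⁻)h(v_*⁻)/(h(v⁺)h(v_*⁺))] the one-body surprisal jump of a collision (pre-velocities by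
reflectVel, h frozen at x_i), K_N[m] = (ε/(N+1)) Σ_{collision times ≤ τ} Σ_{ordered contact pairs}
m; then P( K_N[χ g F(1+e^{−F})] + κ·K_N[χ g F(1−e^{−F})] < −η ) ≤ δ for r, ϑ < r₀(η,δ) and N ≥
N₀(r,ϑ). By ParitySplit the first sum is the J-ODD channel ∫γ_a(hh_*+h′h_*′)F (≡ 0 for every J-even
contact correlation), the second the J-even Boltzmann–Enskog production ∫γ_s(hh_*−h′h_*′)F ≥ 0.
[difficulty: open-problem] -/
@[route_item "route-AtomisticToContinuum-JOddEnslaving"]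
def OddFluxEfficiency : Prop :=
  ∃ η₀ : ℝ, 0 < η₀ ∧ ∃ κ : ℝ, κ < 1 ∧ ∀ (a₀ θ₀ : Literature.MathematicalPhysics.KineticTheory.T3 → ℝ) (u₀ : Literature.MathematicalPhysics.KineticTheory.T3 → Literature.MathematicalPhysics.KineticTheory.V3), Continuous a₀ → Continuous θ₀ → Continuous u₀ → (∀ x, 0 < a₀ x) → (∀ x, 0 < θ₀ x) → ∃ σ₀ : ℝ, 0 < σ₀ ∧ ∀ σ : ℝ, 0 < σ → σ < σ₀ → ∀ Φ : (N : ℕ) → Literature.Analysis.FluidPDE.HardSphereFlow (Literature.Analysis.FluidPDE.Torus.geometry (Fin 3)) (Literature.MathematicalPhysics.KineticTheory.hsDiameter σ N) (N + 1), ∀ τ : ℝ, 0 < τ → ∀ χ : ℝ × UnitAddTorus (Fin 3) → ℝ, Continuous χ → (∀ p, 0 ≤ χ p) → ∀ g : ℝ → ℝ, Continuous g → (∀ a, 0 ≤ g a) → (∀ a, η₀ ≤ a → g a = 0) → ∀ η δ : ℝ, 0 < η → 0 < δ → ∃ r₀ : ℝ, 0 < r₀ ∧ ∀ r ϑ : ℝ,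 0 < r → r < r₀ → 0 < ϑ → ϑ < r₀ → ∃ N₀ : ℕ, ∀ N : ℕ, N₀ ≤ N → let ε := Literature.MathematicalPhysics.KineticTheory.hsDiameter σ N; let G := Literature.Analysis.FluidPDE.Torus.geometry (Fin 3); let γ := fun z (s : ℝ) => (Φ N).flow s z; let bx : UnitAddTorus (Fin 3) → UnitAddTorus (Fin 3) → ℝ := fun x y => 3 / (Real.pi * r ^ 3) * max (1 - Literature.Analysis.FluidPDE.Torus.euclidDist x y / r) 0; let ρm := fun z s (x₀ : UnitAddTorus (Fin 3)) => ∫ q, bx q.1 x₀ ∂(Literature.Analysis.FluidPDE.empiricalMeasure (γ z s)); let hm := fun z s (x₀ : UnitAddTorus (Fin 3)) (v : EuclideanSpace ℝ (Fin 3)) => ∫ q, bx q.1 x₀ * Literature.Analysis.FluidPDE.localMaxwellian 1 (ϑ ^ 2) v q.2 ∂(Literature.Analysis.FluidPDE.empiricalMeasure (γ z s)); let pv := fun z s (i j : Fin (N + 1)) => Literature.Analysis.FluidPDE.reflectVel (G.sepVec (γ z s i).1 (γ z s j).1) ((γ z s i).2, (γ z s j).2); let F := fun z s (i j : Fin (N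 + 1)) => Real.log (hm z s (γ z s i).1 (pv z s i j).1) + Real.log (hm z s (γ z s i).1 (pv z s i j).2) - Real.log (hm z s (γ z s i).1 (γ z s i).2) - Real.log (hm z s (γ z s i).1 (γ z s j).2); let Kc := fun (Fn : Literature.Analysis.FluidPDE.Config (N + 1) (Fin 3) Literature.MathematicalPhysics.KineticTheory.T3 → ℝ → Fin (N + 1) → Fin (N + 1) → ℝ) z => ε / (N + 1 : ℝ) * ∑ᶠ (s : ℝ) (_ : s ∈ Literature.Analysis.FluidPDE.collisionTimes G ε (γ z) ∩ Set.Icc 0 τ), ∑ i : Fin (N + 1), ∑ j : Fin (N + 1), (if i ≠ j ∧ ‖G.sepVec (γ z s i).1 (γ z s j).1‖ = ε then Fn z s i j else 0); let D := fun z => Kc (fun z s i j => χ (s, (γ z s i).1) * g (σ ^ 3 * ρm z s (γ z s i).1) * (F z s i j * (1 + Real.exp (-F z s i j)) + κ * (F z s i j * (1 - Real.exp (-F z s i j))))) z; Literature.MathematicalPhysics.KineticTheory.localGibbsLaw σ a₀ u₀ θ₀ N (Φ N) {z | D z < -η} ≤ ENNReal.ofReal δ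

/-- item stmt-AtomisticToContinuum-8225 · crux · rank 3 · closed · moot by None · by planner
why it might fail: even (J-symmetric) velocity-dependent contact structure at a Maxwellian one-particle state — |g|-dependent approach rates from rings, shear-induced contact anisotropy at finite Kn (Lutsko1996) — is invisible to every entropy functional and would shift p away from ρθZ(ρσ³).
sources: VanbeijerenErnst1973, Resibois1978, Lutsko1996, Ruelle1969, LebowitzPenrose1964, Bogolyubov1975
[crux] CONFIGURATIONAL HALF in flux form (card "(K ⇒ Gibbs)"; CollisionRate stmt-3988 for the two
transfer marks instead of Ψ = 1, no product structure). ∃ η₀ > 0: for σ < σ₀(profiles), every τ,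
continuous χ, continuous cutoff g vanishing on [η₀,∞), the J-EVEN collisional-transfer marks —
momentum Ξ_P^{kl}(n̂,v,w) = ((w−v)·n̂)₊ n̂_k n̂_l (= jump of v_k times n̂_l) and energy Ξ_E^k =
((w−v)·n̂)₊ (n̂·(v+w)/2) n̂_k — evaluated at (ε⁻¹(x_i−x_j), v_i⁻, v_j⁻) satisfy K_N[χ g(σ³ρ_r) Ξ] −
σ³ ∫₀^τ∫ χ g(σ³ρ_r) Y(σ³ρ_r) B^Ξ_r dx ds → 0 in probability (N → ∞ then r → 0), with Y(η) =
(3/2π)·deriv hsExcessFreeEnergy η the thermodynamic contact value, B^Ξ_r the r-mollified ∫∫Θ_Ξ dμ^N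
dμ^N near x and Θ_Ξ(v,w) = ∫Ξ(ω,v,w)((w−v)·ω)₊dω. At a Maxwellian local law the odd correlation
drops out of these fluxes (marks J-even, MM_* dλ J-invariant); this item pins the even part to
Enskog's value, giving p = hsPressure (kinetic ρθ + transfer (2π/3)σ³Yρ²θ) and the energy flux
(E+p)u. [difficulty: open-problem] -/
@[route_item "route-AtomisticToContinuum-JOddEnslaving"]
def EvenFluxEnskog : Prop :=
  ∃ η₀ : ℝ, 0 < η₀ ∧ ∀ (a₀ θ₀ : Literature.MathematicalPhysics.KineticTheory.T3 → ℝ) (u₀ : Literature.MathematicalPhysics.KineticTheory.T3 → Literature.MathematicalPhysics.KineticTheory.V3), Continuous a₀ → Continuous θ₀ → Continuous u₀ → (∀ x, 0 < a₀ x) → (∀ x, 0 < θ₀ x) → ∃ σ₀ : ℝ, 0 < σ₀ ∧ ∀ σ : ℝ, 0 < σ → σ < σ₀ → ∀ Φ : (N : ℕ) → Literature.Analysis.FluidPDE.HardSphereFlow (Literature.Analysis.FluidPDE.Torus.geometry (Fin 3)) (Literature.MathematicalPhysics.KineticTheory.hsDiameter σ N) (N + 1), ∀ τ : ℝ, 0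 < τ → ∀ χ : ℝ × UnitAddTorus (Fin 3) → ℝ, Continuous χ → ∀ g : ℝ → ℝ, Continuous g → (∀ a, η₀ ≤ a → g a = 0) → ∀ η δ : ℝ, 0 < η → 0 < δ → ∃ r₀ : ℝ, 0 < r₀ ∧ ∀ r : ℝ, 0 < r → r < r₀ → ∃ N₀ : ℕ, ∀ N : ℕ, N₀ ≤ N → let ε := Literature.MathematicalPhysics.KineticTheory.hsDiameter σ N; let G := Literature.Analysis.FluidPDE.Torus.geometry (Fin 3); let γ := fun z (s : ℝ) => (Φ N).flow s z; let bx : UnitAddTorus (Fin 3) → UnitAddTorus (Fin 3) → ℝ := fun x y => 3 / (Real.pi * r ^ 3) * max (1 - Literature.Analysis.FluidPDE.Torus.euclidDist x y / r) 0; let ρm := fun z s (x₀ : UnitAddTorus (Fin 3)) => ∫ q, bx q.1 x₀ ∂(Literature.Analysis.FluidPDE.empiricalMeasure (γ z s)); let Θ := fun (Ξ : EuclideanSpace ℝ (Fin 3) × EuclideanSpace ℝ (Fin 3) × EuclideanSpace ℝ (Fin 3) → ℝ) (v w : EuclideanSpace ℝ (Fin 3)) => ∫ ω : Metric.sphere (0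 : EuclideanSpace ℝ (Fin 3)) 1, Ξ ((ω : EuclideanSpace ℝ (Fin 3)), v, w) * Literature.MathematicalPhysics.KineticTheory.hardSphereKernel (w, v) ω ∂Literature.MathematicalPhysics.KineticTheory.sphereMeasure; let B := fun Ξ z s (x₀ : UnitAddTorus (Fin 3)) => ∫ p, bx p.1.1 x₀ * bx p.2.1 x₀ * Θ Ξ p.1.2 p.2.2 ∂((Literature.Analysis.FluidPDE.empiricalMeasure (γ z s)).prod (Literature.Analysis.FluidPDE.empiricalMeasure (γ z s))); let pv := fun z s (i j : Fin (N + 1)) => Literature.Analysis.FluidPDE.reflectVel (G.sepVec (γ z s i).1 (γ z s j).1) ((γ z s i).2, (γ z s j).2); let Kc := fun (Fn : Literature.Analysis.FluidPDE.Config (N + 1) (Fin 3) Literature.MathematicalPhysics.KineticTheory.T3 → ℝ → Fin (N + 1) → Fin (N + 1) → ℝ) z => ε / (N + 1 : ℝ) * ∑ᶠ (s : ℝ) (_ : s ∈ Literature.Analysis.FluidPDE.collisionTimes G ε (γ z) ∩ Set.Icc 0 τ), ∑ i : Fin (N + 1), ∑ j : Fin (N + 1), (if i ≠ j ∧ ‖G.sepVec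 (γ z s i).1 (γ z s j).1‖ = ε then Fn z s i j else 0); let Y : ℝ → ℝ := fun a => 3 / (2 * Real.pi) * deriv Literature.MathematicalPhysics.KineticTheory.hsExcessFreeEnergy a; let Dm := fun (Ξ : EuclideanSpace ℝ (Fin 3) × EuclideanSpace ℝ (Fin 3) × EuclideanSpace ℝ (Fin 3) → ℝ) z => Kc (fun z s i j => χ (s, (γ z s i).1) * g (σ ^ 3 * ρm z s (γ z s i).1) * Ξ (ε⁻¹ • G.sepVec (γ z s i).1 (γ z s j).1, (pv z s i j).1, (pv z s i j).2)) z - σ ^ 3 * ∫ s in Set.Icc (0 : ℝ) τ, ∫ x : UnitAddTorus (Fin 3), χ (s, x) * g (σ ^ 3 * ρm z s x) * Y (σ ^ 3 * ρm z s x) * B Ξ z s x; let ΞP := fun (k l : Fin 3) (q : EuclideanSpace ℝ (Fin 3) × EuclideanSpace ℝ (Fin 3) × EuclideanSpace ℝ (Fin 3)) => max ⟪q.2.2 - q.2.1, q.1⟫_ℝ 0 * (q.1 k * q.1 l); let ΞE := fun (k : Fin 3) (q : EuclideanSpace ℝ (Fin 3) × EuclideanSpace ℝ (Fin 3) × EuclideanSpace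 ℝ (Fin 3)) => max ⟪q.2.2 - q.2.1, q.1⟫_ℝ 0 * (⟪q.2.1 + q.2.2, q.1⟫_ℝ / 2) * q.1 k; (∀ k l : Fin 3, Literature.MathematicalPhysics.KineticTheory.localGibbsLaw σ a₀ u₀ θ₀ N (Φ N) {z | η < |Dm (ΞP k l) z|} ≤ ENNReal.ofReal δ) ∧ (∀ k : Fin 3, Literature.MathematicalPhysics.KineticTheory.localGibbsLaw σ a₀ u₀ θ₀ N (Φ N) {z | η < |Dm (ΞE k) z|} ≤ ENNReal.ofReal δ)

/-- item stmt-AtomisticToContinuum-8226 · crux · rank 4 · closed · moot by None · by planner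
why it might fail: dynamical screening could suppress approach rates of slow pairs (|g| → 0) or of shadowed geometries below any UNIFORM multiple of the ideal rate; a velocity-dependent floor g₀(|g|,n̂) would still serve but is not what is filed.
sources: VanbeijerenErnst1973, Resibois1978, PulvirentiSimonellaTrushechkin2018, GST2013
[crux] NO COLLISION AVOIDANCE (merged card clause G_s ≥ g₀). ∃ g₀ > 0: for σ < σ₀(profiles), every
τ, continuous χ ≥ 0 and every bounded continuous mark Ξ ≥ 0 of (n̂, v⁻, v_*⁻): P( K_N[χ Ξ] < g₀ σ³
∫₀^τ∫ χ B^Ξ_r dx ds − η ) ≤ δ for r < r₀, N ≥ N₀(r). In the limit: κ̄ ≥ g₀σ³((w−v)·n̂)₊ dn̂ μ̄⊗μ̄ —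
every pair of locally present velocities collides at every impact geometry at rate ≥ g₀ × ideal-gas
rate (Enskog predicts γ ≥ Y ≥ 1). Supplies the thickness of the limit contact law that
ParityRigidity consumes; no density cutoff (crowding raises rates). [difficulty: L] -/
@[route_item "route-AtomisticToContinuum-JOddEnslaving"]
def RateFloor : Prop :=
  ∃ g₀ : ℝ, 0 < g₀ ∧ ∀ (a₀ θ₀ : Literature.MathematicalPhysics.KineticTheory.T3 → ℝ) (u₀ : Literature.MathematicalPhysics.KineticTheory.T3 → Literature.MathematicalPhysics.KineticTheory.V3), Continuous a₀ → Continuous θ₀ → Continuous u₀ → (∀ x, 0 < a₀ x) → (∀ x, 0 < θ₀ x) → ∃ σ₀ : ℝ, 0 < σ₀ ∧ ∀ σ : ℝ, 0 < σ → σ < σ₀ → ∀ Φ : (N : ℕ) → Literature.Analysis.FluidPDE.HardSphereFlow (Literature.Analysis.FluidPDE.Torus.geometry (Fin 3)) (Literature.MathematicalPhysics.KineticTheory.hsDiameter σ N) (N + 1), ∀ τ : ℝ, 0 < τ → ∀ χ : ℝ × UnitAddTorus (Fin 3) → ℝ, Continuous χ → (∀ p, 0 ≤ χ p) → ∀ Ξ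 : EuclideanSpace ℝ (Fin 3) × EuclideanSpace ℝ (Fin 3) × EuclideanSpace ℝ (Fin 3) → ℝ, Continuous Ξ → (∀ q, 0 ≤ Ξ q) → (∃ C : ℝ, ∀ q, Ξ q ≤ C) → ∀ η δ : ℝ, 0 < η → 0 < δ → ∃ r₀ : ℝ, 0 < r₀ ∧ ∀ r : ℝ, 0 < r → r < r₀ → ∃ N₀ : ℕ, ∀ N : ℕ, N₀ ≤ N → let ε := Literature.MathematicalPhysics.KineticTheory.hsDiameter σ N; let G := Literature.Analysis.FluidPDE.Torus.geometry (Fin 3); let γ := fun z (s : ℝ) => (Φ N).flow s z; let bx : UnitAddTorus (Fin 3) → UnitAddTorus (Fin 3) → ℝ := fun x y => 3 / (Real.pi * r ^ 3) * max (1 - Literature.Analysis.FluidPDE.Torus.euclidDist x y / r) 0; let Θ := fun (Ξ : EuclideanSpace ℝ (Fin 3) × EuclideanSpace ℝ (Fin 3) × EuclideanSpace ℝ (Fin 3) → ℝ) (v w : EuclideanSpace ℝ (Fin 3)) => ∫ ω : Metric.sphere (0 : EuclideanSpace ℝ (Fin 3)) 1, Ξ ((ω : EuclideanSpace ℝ (Fin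 3)), v, w) * Literature.MathematicalPhysics.KineticTheory.hardSphereKernel (w, v) ω ∂Literature.MathematicalPhysics.KineticTheory.sphereMeasure; let B := fun Ξ z s (x₀ : UnitAddTorus (Fin 3)) => ∫ p, bx p.1.1 x₀ * bx p.2.1 x₀ * Θ Ξ p.1.2 p.2.2 ∂((Literature.Analysis.FluidPDE.empiricalMeasure (γ z s)).prod (Literature.Analysis.FluidPDE.empiricalMeasure (γ z s))); let pv := fun z s (i j : Fin (N + 1)) => Literature.Analysis.FluidPDE.reflectVel (G.sepVec (γ z s i).1 (γ z s j).1) ((γ z s i).2, (γ z s j).2); let Kc := fun (Fn : Literature.Analysis.FluidPDE.Config (N + 1) (Fin 3) Literature.MathematicalPhysics.KineticTheory.T3 → ℝ → Fin (N + 1) → Fin (N + 1) → ℝ) z => ε / (N + 1 : ℝ) * ∑ᶠ (s : ℝ) (_ : s ∈ Literature.Analysis.FluidPDE.collisionTimes G ε (γ z) ∩ Set.Icc 0 τ), ∑ i : Fin (N + 1), ∑ j : Fin (N + 1), (if i ≠ j ∧ ‖G.sepVec (γ z s i).1 (γ z s j).1‖ = ε then Fn z s i j else 0); Literature.MathematicalPhysics.KineticTheory.localGibbsLaw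 σ a₀ u₀ θ₀ N (Φ N) {z | Kc (fun z s i j => χ (s, (γ z s i).1) * Ξ (ε⁻¹ • G.sepVec (γ z s i).1 (γ z s j).1, (pv z s i j).1, (pv z s i j).2)) z < g₀ * σ ^ 3 * (∫ s in Set.Icc (0 : ℝ) τ, ∫ x : UnitAddTorus (Fin 3), χ (s, x) * B Ξ z s x) - η} ≤ ENNReal.ofReal δ

/-- item stmt-AtomisticToContinuum-3989 · crux · rank 5 · closed · moot by None · by planner
why it might fail: at Euler scaling the leading production vanishes by free balance and the local sign is that of the O(Kn) deviation (Navier–Stokes-order dissipation, incl. the configurational entropy current); no in-probability local second law is known for deterministic spheres.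
sources: FeireislNovotny2012, BrezinaFeireisl2018, Resibois1978, OllaVaradhanYau1993, Spohn1991
[crux] LOCAL ENTROPY INEQUALITY IN PROBABILITY for the r-mollified empirical fields (ρ, m, e)^N_r
with θ = (2/3)(e/ρ − |m|²/2ρ²) and mathematical entropy H(ρ,θ) = −ρ(3/2 log θ − log ρ −
hsExcessFreeEnergy(ρσ³)): for every smooth φ ≥ 0 supported in [0,τ) × 𝕋³, P(∫∫ H (∂_sφ + (m/ρ)·∇φ)
dx ds + ∫ H(ρ(0),θ(0)) φ(0) dx < −η) → 0 as N → ∞ then r → 0, under the conjunct's hypotheses (Euler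
data (ρ,u,θ)(0) = limits of the local Gibbs fields). This is the admissibility the Feireisl–Novotný
/ Březina–Feireisl relative-energy method consumes for the COMPLETE Euler system (energy only
globally, exact here); the GLOBAL Clausius inequality in expectation is free (Liouville + Gibbs
variational bound), the local one is not. [difficulty: open-problem] -/
@[route_item "route-AtomisticToContinuum-JOddEnslaving"]
def LocalSecondLaw : Prop :=
  ∀ (a₀ θ₀ : Literature.MathematicalPhysics.KineticTheory.T3 → ℝ) (u₀ : Literature.MathematicalPhysics.KineticTheory.T3 → Literature.MathematicalPhysics.KineticTheory.V3), Continuous a₀ → Continuous θ₀ → Continuous u₀ → (∀ x, 0 < a₀ x) → (∀ x, 0 < θ₀ x) → ∃ σ₀ : ℝ, 0 < σ₀ ∧ ∀ σ : ℝ, 0 < σ → σ < σ₀ → ∀ (T : ℝ) (ρ θ : ℝ → Literature.MathematicalPhysics.KineticTheory.T3 → ℝ) (u : ℝ → Literature.MathematicalPhysics.KineticTheory.T3 → Literature.MathematicalPhysics.KineticTheory.V3), Literature.MathematicalPhysics.KineticTheory.IsHardSphereEulerSolution σ T ρ u θ → ∀ Φ : (N : ℕ) → Literature.Analysis.FluidPDE.HardSphereFlow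 (Literature.Analysis.FluidPDE.Torus.geometry (Fin 3)) (Literature.MathematicalPhysics.KineticTheory.hsDiameter σ N) (N + 1), Literature.MathematicalPhysics.KineticTheory.TendstoHydroFieldsAt (fun N => Literature.MathematicalPhysics.KineticTheory.localGibbsLaw σ a₀ u₀ θ₀ N (Φ N)) Φ ρ u θ 0 → 0 < T → ∀ τ : ℝ, 0 < τ → ∀ φ : ℝ → Literature.MathematicalPhysics.KineticTheory.T3 → ℝ, Literature.Analysis.FunctionSpaces.Torus.IsSmoothSpaceTimeOn Set.univ φ → (∀ s x, 0 ≤ φ s x) → (∃ τ' : ℝ, τ' < τ ∧ ∀ s, τ' ≤ s → ∀ x, φ s x = 0) → ∀ η δ : ℝ, 0 < η → 0 < δ → ∃ r₀ : ℝ, 0 < r₀ ∧ ∀ r : ℝ, 0 < r → r < r₀ → ∃ N₀ : ℕ, ∀ N : ℕ, N₀ ≤ N → let γ : Literature.Analysis.FluidPDE.Config (N + 1) (Fin 3) Literature.MathematicalPhysics.KineticTheory.T3 → ℝ → Literature.Analysis.FluidPDE.Config (N + 1) (Fin 3) Literature.MathematicalPhysics.KineticTheory.T3 := fun z s => (Φ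 N).flow s z; let bx : Literature.MathematicalPhysics.KineticTheory.T3 → Literature.MathematicalPhysics.KineticTheory.T3 → ℝ := fun x y => 3 / (Real.pi * r ^ 3) * max (1 - Literature.Analysis.FluidPDE.Torus.euclidDist x y / r) 0; let ρm : Literature.Analysis.FluidPDE.Config (N + 1) (Fin 3) Literature.MathematicalPhysics.KineticTheory.T3 → ℝ → Literature.MathematicalPhysics.KineticTheory.T3 → ℝ := fun z s x₀ => ∫ q, bx q.1 x₀ ∂(Literature.Analysis.FluidPDE.empiricalMeasure (γ z s)); let mm : Literature.Analysis.FluidPDE.Config (N + 1) (Fin 3) Literature.MathematicalPhysics.KineticTheory.T3 → ℝ → Literature.MathematicalPhysics.KineticTheory.T3 → Literature.MathematicalPhysics.KineticTheory.V3 := fun z s x₀ => ∫ q, bx q.1 x₀ • q.2 ∂(Literature.Analysis.FluidPDE.empiricalMeasure (γ z s)); let em : Literature.Analysis.FluidPDE.Config (N + 1) (Fin 3) Literature.MathematicalPhysics.KineticTheory.T3 → ℝ → Literature.MathematicalPhysics.KineticTheory.T3 → ℝ := fun z s x₀ => ∫ q, bx q.1 x₀ * (‖q.2‖ ^ 2 /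 2) ∂(Literature.Analysis.FluidPDE.empiricalMeasure (γ z s)); let θm : Literature.Analysis.FluidPDE.Config (N + 1) (Fin 3) Literature.MathematicalPhysics.KineticTheory.T3 → ℝ → Literature.MathematicalPhysics.KineticTheory.T3 → ℝ := fun z s x₀ => 2 / 3 * (em z s x₀ / ρm z s x₀ - ‖mm z s x₀‖ ^ 2 / (2 * ρm z s x₀ ^ 2)); let Hs : ℝ → ℝ → ℝ := fun a b => if 0 < a ∧ 0 < b then -(a * (3 / 2 * Real.log b - Real.log a - Literature.MathematicalPhysics.KineticTheory.hsExcessFreeEnergy (a * σ ^ 3))) else 0; let I : Literature.Analysis.FluidPDE.Config (N + 1) (Fin 3) Literature.MathematicalPhysics.KineticTheory.T3 → ℝ := fun z => ∫ s in Set.Icc (0 : ℝ) τ, ∫ x : Literature.MathematicalPhysics.KineticTheory.T3, Hs (ρm z s x) (θm z s x) * (deriv (fun s' => φ s' x) s + ∑ k : Fin 3, (mm z s x) k / ρm z s x * Literature.Analysis.FunctionSpaces.Torus.partialDeriv k (φ s) x); Literature.MathematicalPhysics.KineticTheory.localGibbsLaw σ a₀ u₀ θ₀ N (Φ N) {z |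 I z + ∫ x : Literature.MathematicalPhysics.KineticTheory.T3, Hs (ρ 0 x) (θ 0 x) * φ 0 x < -η} ≤ ENNReal.ofReal δ

/-- item stmt-AtomisticToContinuum-3990 · crux · rank 6 · closed · moot by None · by planner
why it might fail: transient mesoscopic pre-crystalline clusters ahead of steepening compressive waves; there is no maximum principle for the empirical density of the particle system, and for implosion-type data the Euler density itself leaves the fluid branch near T.
sources: Spohn1991, OllaVaradhanYau1993, Ruelle1969
[crux] NO OVERCOMPRESSION BEFORE THE SHOCK: under the conjunct's hypotheses, for every t < T and η >
0, P(∃ s ≤ t, ∃ x: ρ^N_r(s,x) > ρ(s,x) + η) → 0 as N → ∞ then r → 0 (ρ = the classical Euler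
density). Needed because on sets of reduced density ≥ η₀ the collisional fluxes are neither
identified (CollisionRate is cut off) nor a priori bounded (contact values blow up toward close
packing), so they cannot be absorbed in the relative-energy Gronwall; at each FIXED scale r a
scale-dependent cap is free by entropy transfer against the invariant Gibbs law, the scale-uniform
one-sided bound is not. [difficulty: L] -/
@[route_item "route-AtomisticToContinuum-JOddEnslaving"]
def DensityCap : Prop :=
  ∀ (a₀ θ₀ : Literature.MathematicalPhysics.KineticTheory.T3 → ℝ) (u₀ : Literature.MathematicalPhysics.KineticTheory.T3 → Literature.MathematicalPhysics.KineticTheory.V3), Continuous a₀ → Continuous θ₀ → Continuous u₀ → (∀ x, 0 < a₀ x) → (∀ x, 0 < θ₀ x) → ∃ σ₀ : ℝ, 0 < σ₀ ∧ ∀ σ : ℝ, 0 < σ → σ < σ₀ → ∀ (T : ℝ) (ρ θ : ℝ → Literature.MathematicalPhysics.KineticTheory.T3 → ℝ) (u : ℝ → Literature.MathematicalPhysics.KineticTheory.T3 → Literature.MathematicalPhysics.KineticTheory.V3), Literature.MathematicalPhysics.KineticTheory.IsHardSphereEulerSolution σ T ρ u θ → ∀ Φ : (N : ℕ) → Literature.Analysis.FluidPDE.HardSphereFlow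 (Literature.Analysis.FluidPDE.Torus.geometry (Fin 3)) (Literature.MathematicalPhysics.KineticTheory.hsDiameter σ N) (N + 1), Literature.MathematicalPhysics.KineticTheory.TendstoHydroFieldsAt (fun N => Literature.MathematicalPhysics.KineticTheory.localGibbsLaw σ a₀ u₀ θ₀ N (Φ N)) Φ ρ u θ 0 → ∀ t ∈ Set.Ico 0 T, ∀ η δ : ℝ, 0 < η → 0 < δ → ∃ r₀ : ℝ, 0 < r₀ ∧ ∀ r : ℝ, 0 < r → r < r₀ → ∃ N₀ : ℕ, ∀ N : ℕ, N₀ ≤ N → let γ : Literature.Analysis.FluidPDE.Config (N + 1) (Fin 3) Literature.MathematicalPhysics.KineticTheory.T3 → ℝ → Literature.Analysis.FluidPDE.Config (N + 1) (Fin 3) Literature.MathematicalPhysics.KineticTheory.T3 := fun z s => (Φ N).flow s z; let bx : Literature.MathematicalPhysics.KineticTheory.T3 → Literature.MathematicalPhysics.KineticTheory.T3 → ℝ := fun x y => 3 / (Real.pi * r ^ 3) * max (1 - Literature.Analysis.FluidPDE.Torus.euclidDist x y / r) 0; let ρm : Literature.Analysis.FluidPDE.Config (N + 1) (Fin 3)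 Literature.MathematicalPhysics.KineticTheory.T3 → ℝ → Literature.MathematicalPhysics.KineticTheory.T3 → ℝ := fun z s x₀ => ∫ q, bx q.1 x₀ ∂(Literature.Analysis.FluidPDE.empiricalMeasure (γ z s)); Literature.MathematicalPhysics.KineticTheory.localGibbsLaw σ a₀ u₀ θ₀ N (Φ N) {z | ∃ s ∈ Set.Icc 0 t, ∃ x : Literature.MathematicalPhysics.KineticTheory.T3, ρ s x + η < ρm z s x} ≤ ENNReal.ofReal δ

/-- item stmt-AtomisticToContinuum-0768 · support · rank 9 · open · by planner
sources: Ruelle1969, LebowitzPenrose1964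
[support] Hard-sphere equation of state at low density: ∃ η₀ > 0 and F real-analytic on (−η₀, η₀)
with hsExcessFreeEnergy = F on [0, η₀), F(0) = 0, F'(0) = 2π/3 (second virial coefficient of
unit-diameter spheres), and the canonical thermodynamic limit −N⁻¹ log hsFreeVolume η N → F(η)
exists (not just limsup) for η ∈ [0, η₀). Ruelle1969 §3.4 (existence), LebowitzPenrose1964
(convergence of the virial expansion ⇒ analyticity). Makes hsCompressibility/hsPressure smooth and
Z(η) = 1 + (2π/3)η + O(η²); needed by every route (hyperbolicity of the Euler system, virial
theorem). -/
@[route_item "route-AtomisticToContinuum-JOddEnslaving"]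
def HsEosLowDensity : Prop :=
  ∃ η₀ : ℝ, 0 < η₀ ∧ ∃ F : ℝ → ℝ, AnalyticOnNhd ℝ F (Set.Ioo (-η₀) η₀) ∧ Set.EqOn Literature.MathematicalPhysics.KineticTheory.hsExcessFreeEnergy F (Set.Ico 0 η₀) ∧ F 0 = 0 ∧ deriv F 0 = 2 * Real.pi / 3 ∧ ∀ η ∈ Set.Ico 0 η₀, Filter.Tendsto (fun N : ℕ => -(N : ℝ)⁻¹ * Real.log (Literature.MathematicalPhysics.KineticTheory.hsFreeVolume η N)) Filter.atTop (nhds (F η))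

/-- item stmt-AtomisticToContinuum-3991 · support · rank 9 · closed · moot by None · by planner
sources: PulvirentiSimonellaTrushechkin2018, GST2013, Spohn1991
[support] tightness of the normalised collision count (card S1): for σ < σ₀(profiles), every τ and δ
there are K, N₀ with P((ε/(N+1))·#collisions in [0,τ] > K) ≤ δ for N ≥ N₀ (ε = hsDiameter σ N;
#collisions = FP.numCollisions of the flow trajectory). Expected proof: Cauchy–Schwarz transfer of
an equilibrium large-deviation bound for excess collision counts from the invariant canonical Gibbs
law (card spacetime-superextensive-ld); not routine (super-extensive count N^{4/3}). [difficulty: M] -/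
@[route_item "route-AtomisticToContinuum-JOddEnslaving"]
def CollisionTightness : Prop :=
  ∀ (a₀ θ₀ : Literature.MathematicalPhysics.KineticTheory.T3 → ℝ) (u₀ : Literature.MathematicalPhysics.KineticTheory.T3 → Literature.MathematicalPhysics.KineticTheory.V3), Continuous a₀ → Continuous θ₀ → Continuous u₀ → (∀ x, 0 < a₀ x) → (∀ x, 0 < θ₀ x) → ∃ σ₀ : ℝ, 0 < σ₀ ∧ ∀ σ : ℝ, 0 < σ → σ < σ₀ → ∀ Φ : (N : ℕ) → Literature.Analysis.FluidPDE.HardSphereFlow (Literature.Analysis.FluidPDE.Torus.geometry (Fin 3)) (Literature.MathematicalPhysics.KineticTheory.hsDiameter σ N) (N + 1), ∀ τ : ℝ, 0 < τ → ∀ δ : ℝ, 0 < δ → ∃ K : ℝ, ∃ N₀ : ℕ, ∀ N : ℕ, N₀ ≤ N → Literature.MathematicalPhysics.KineticTheory.localGibbsLaw σ a₀ u₀ θ₀ N (Φ N) {z | K < Literature.MathematicalPhysics.KineticTheory.hsDiameter σ N / (N + 1 : ℝ) * (Literature.Analysis.FluidPDE.numCollisions (Literature.Analysis.FluidPDE.Torus.geometry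 (Fin 3)) (Literature.MathematicalPhysics.KineticTheory.hsDiameter σ N) (fun s => (Φ N).flow s z) 0 τ : ℝ)} ≤ ENNReal.ofReal δ

/-- item stmt-AtomisticToContinuum-3993 · support · rank 9 · closed · moot by None · by planner
sources: Bogolyubov1975, PulvirentiSimonellaTrushechkin2018, GST2013
[support] the EXACT IDENTITY for empirical measures along one trajectory (card S2; Bogolyubov's
microscopic Enskog equation, torus version): for every hard-sphere flow Φ on 𝕋³ (any ε > 0, N),
every good z, τ > 0, a ∈ C¹(ℝ), smooth b on 𝕋³ and any c on ℝ³: a(τ)⟨μ_τ, b c⟩ − a(0)⟨μ_0, b c⟩ −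
∫_0^τ [a′⟨μ_s, b c⟩ + a⟨μ_s, (v·∇b) c⟩] ds = N⁻¹ Σ_{collision times s ∈ (0,τ]} a(s) Σ_{ordered
contact pairs (i,j)} b(x_i)[c(v_i) − c((reflectVel (x_i−x_j) (v_i,v_j)).1)] (μ_s = empiricalMeasure
of Φ_s z; right-continuous trajectories, pre-collisional velocities by the involution reflectVel).
[difficulty: provable-now] -/
@[route_item "route-AtomisticToContinuum-JOddEnslaving"]
def EmpiricalEnskogIdentity : Prop :=
  ∀ (ε : ℝ) (N : ℕ), 0 < ε → ∀ Φ : Literature.Analysis.FluidPDE.HardSphereFlow (Literature.Analysis.FluidPDE.Torus.geometry (Fin 3)) ε N, ∀ z ∈ Φ.good, ∀ τ : ℝ, 0 < τ → ∀ a : ℝ → ℝ, ContDiff ℝ 1 a → ∀ b : Literature.MathematicalPhysics.KineticTheory.T3 → ℝ, Literature.Analysis.FunctionSpaces.Torus.IsSmooth b → ∀ c : Literature.MathematicalPhysics.KineticTheory.V3 → ℝ, let G : Literature.Analysis.FluidPDE.Geometry (Fin 3) Literature.MathematicalPhysics.KineticTheory.T3 := Literature.Analysis.FluidPDE.Torus.geometry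 (Fin 3); let γ : ℝ → Literature.Analysis.FluidPDE.Config N (Fin 3) Literature.MathematicalPhysics.KineticTheory.T3 := fun s => Φ.flow s z; a τ * ∫ q, b q.1 * c q.2 ∂(Literature.Analysis.FluidPDE.empiricalMeasure (γ τ)) - a 0 * ∫ q, b q.1 * c q.2 ∂(Literature.Analysis.FluidPDE.empiricalMeasure (γ 0)) - ∫ s in Set.Icc (0 : ℝ) τ, (deriv a s * ∫ q, b q.1 * c q.2 ∂(Literature.Analysis.FluidPDE.empiricalMeasure (γ s)) + a s * ∫ q, (∑ k : Fin 3, q.2 k * Literature.Analysis.FunctionSpaces.Torus.partialDeriv k b q.1) * c q.2 ∂(Literature.Analysis.FluidPDE.empiricalMeasure (γ s))) = (N : ℝ)⁻¹ * ∑ᶠ (s : ℝ) (_ : s ∈ Literature.Analysis.FluidPDE.collisionTimes G ε γ ∩ Set.Ioc 0 τ), a s * ∑ i : Fin N, ∑ j : Fin N, (if i ≠ j ∧ ‖G.sepVec (γ s i).1 (γ s j).1‖ = ε then b (γ s i).1 * (c (γ s i).2 - c (Literature.Analysis.FluidPDE.reflectVel (G.sepVec (γ s i).1 (γ s j).1)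 ((γ s i).2, (γ s j).2)).1) else 0)

/-- item stmt-AtomisticToContinuum-8227 · support · rank 9 · closed · moot by None · by planner
sources: CIP1994, Villani2002, Resibois1978
[support] THE H-SPLIT IN EVENT FORM (cards P1; provable now). For a measurable contact kernel
K(v,v_*,ω) (= γ × hard-sphere rate), h > 0 and F = log(hh_*/h′h_*′), with K_s, K_a the J-even/odd
parts (J = (collide, −ω), measure-preserving: tree `measurePreserving_collideSwap_prod`,
`measurePreserving_swap_negDir`) and two integrability side conditions: ∫K hh_* F(1−e^{−F}) =
∫K_s(hh_*−h′h_*′)F = 4·entropyProduction K_s h (≥ 0 for K ≥ 0 by `entropyProduction_nonneg`) and ∫K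
hh_* F(1+e^{−F}) = ∫K_a(hh_*+h′h_*′)F — so the odd event statistic vanishes for every J-even K
(Enskog, any position-only or |g|,|g·ω|-dependent structure) and adding the two gives σ = ½∫K hh_* F
= ¼∫K_sAF + ¼∫K_aBF. [difficulty: provable-now] -/
@[route_item "route-AtomisticToContinuum-JOddEnslaving"]
def ParitySplit : Prop :=
  ∀ (K : Literature.MathematicalPhysics.KineticTheory.V3 × Literature.MathematicalPhysics.KineticTheory.V3 → Metric.sphere (0 : Literature.MathematicalPhysics.KineticTheory.V3) 1 → ℝ) (h : Literature.MathematicalPhysics.KineticTheory.V3 → ℝ), Measurable (Function.uncurry K) → (∀ v, 0 < h v) → let F : (Literature.MathematicalPhysics.KineticTheory.V3 × Literature.MathematicalPhysics.KineticTheory.V3) × Metric.sphere (0 : Literature.MathematicalPhysics.KineticTheory.V3) 1 → ℝ := fun q => Real.log (h q.1.1 * h q.1.2 / (h (Literature.MathematicalPhysics.KineticTheory.collide q.2 q.1).1 * h (Literature.MathematicalPhysics.KineticTheory.collide q.2 q.1).2)); let Ks : Literature.MathematicalPhysics.KineticTheory.V3 × Literature.MathematicalPhysics.KineticTheory.V3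 → Metric.sphere (0 : Literature.MathematicalPhysics.KineticTheory.V3) 1 → ℝ := fun p ω => (K p ω + K (Literature.MathematicalPhysics.KineticTheory.collide ω p) (-ω)) / 2; let Ka : Literature.MathematicalPhysics.KineticTheory.V3 × Literature.MathematicalPhysics.KineticTheory.V3 → Metric.sphere (0 : Literature.MathematicalPhysics.KineticTheory.V3) 1 → ℝ := fun p ω => (K p ω - K (Literature.MathematicalPhysics.KineticTheory.collide ω p) (-ω)) / 2; MeasureTheory.Integrable (fun q => K q.1 q.2 * (h q.1.1 * h q.1.2) * F q) (((MeasureTheory.volume : MeasureTheory.Measure Literature.MathematicalPhysics.KineticTheory.V3).prod MeasureTheory.volume).prod Literature.MathematicalPhysics.KineticTheory.sphereMeasure) → MeasureTheory.Integrable (fun q => K q.1 q.2 * (h (Literature.MathematicalPhysics.KineticTheory.collide q.2 q.1).1 * h (Literature.MathematicalPhysics.KineticTheory.collide q.2 q.1).2) * F q) (((MeasureTheory.volume : MeasureTheory.Measure Literature.MathematicalPhysics.KineticTheory.V3).prod MeasureTheory.volume).prod Literature.MathematicalPhysics.KineticTheory.sphereMeasure) → (∫ q, K q.1 q.2 * (h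 q.1.1 * h q.1.2) * (F q * (1 - Real.exp (-F q))) ∂(((MeasureTheory.volume : MeasureTheory.Measure Literature.MathematicalPhysics.KineticTheory.V3).prod MeasureTheory.volume).prod Literature.MathematicalPhysics.KineticTheory.sphereMeasure) = ∫ q, Ks q.1 q.2 * (h q.1.1 * h q.1.2 - h (Literature.MathematicalPhysics.KineticTheory.collide q.2 q.1).1 * h (Literature.MathematicalPhysics.KineticTheory.collide q.2 q.1).2) * F q ∂(((MeasureTheory.volume : MeasureTheory.Measure Literature.MathematicalPhysics.KineticTheory.V3).prod MeasureTheory.volume).prod Literature.MathematicalPhysics.KineticTheory.sphereMeasure)) ∧ (∫ q, K q.1 q.2 * (h q.1.1 * h q.1.2) * (F q * (1 + Real.exp (-F q))) ∂(((MeasureTheory.volume : MeasureTheory.Measure Literature.MathematicalPhysics.KineticTheory.V3).prod MeasureTheory.volume).prod Literature.MathematicalPhysics.KineticTheory.sphereMeasure) = ∫ q, Ka q.1 q.2 * (h q.1.1 * h q.1.2 + h (Literature.MathematicalPhysics.KineticTheory.collide q.2 q.1).1 * h (Literature.MathematicalPhysics.KineticTheory.collide q.2 q.1).2) * F q ∂(((MeasureTheory.volume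 : MeasureTheory.Measure Literature.MathematicalPhysics.KineticTheory.V3).prod MeasureTheory.volume).prod Literature.MathematicalPhysics.KineticTheory.sphereMeasure)) ∧ (∫ q, Ks q.1 q.2 * (h q.1.1 * h q.1.2 - h (Literature.MathematicalPhysics.KineticTheory.collide q.2 q.1).1 * h (Literature.MathematicalPhysics.KineticTheory.collide q.2 q.1).2) * F q ∂(((MeasureTheory.volume : MeasureTheory.Measure Literature.MathematicalPhysics.KineticTheory.V3).prod MeasureTheory.volume).prod Literature.MathematicalPhysics.KineticTheory.sphereMeasure) = 4 * Literature.Analysis.FluidPDE.entropyProduction Ks h)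

/-- item stmt-AtomisticToContinuum-8228 · support · rank 9 · closed · moot by None · by planner
sources: CIP1994, Villani2002, LuMouhot2015, DesvillettesVillani2005
[support] VANISHING EVEN PRODUCTION IS RIGID (velocity space; replaces BalanceRigidity stmt-3992 for
this route). For a probability measure m on ℝ³ with finite second moment, h_ϑ = m ∗ Gaussian_ϑ and
F_ϑ(ω,v,w) = log[h_ϑ(v)h_ϑ(w)/(h_ϑ(v′)h_ϑ(w′))]: if the even production against the ideal contact
law, ∫∫∫((w−v)·ω)₊ F_ϑ(1−e^{−F_ϑ}) dω m(dv)m(dw) (a lower integral, +∞ allowed), tends to 0 as ϑ →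
0⁺, then m is a point mass or a Maxwellian law. Proof sketch: singular m makes the integral blow up
(collisions knock mass off the support); absolutely continuous m gives, by Fatou,
(hh_*−h′h_*′)log(hh_*/h′h_*′) = 0 a.e., so log h is a continuous collision invariant (tree
`IsCollisionInvariant.exists_eq_quadratic_holds`, `integral_collisionOp_mul_log_eq_zero_iff_holds`).
[difficulty: M] -/
@[route_item "route-AtomisticToContinuum-JOddEnslaving"]
def ParityRigidity : Prop :=
  ∀ (m : MeasureTheory.Measure Literature.MathematicalPhysics.KineticTheory.V3) [MeasureTheory.IsProbabilityMeasure m], MeasureTheory.Integrable (fun v => ‖v‖ ^ 2) m → (let h : ℝ → Literature.MathematicalPhysics.KineticTheory.V3 → ℝ := fun ϑ v => ∫ v', Literature.Analysis.FluidPDE.localMaxwellian 1 (ϑ ^ 2) v v' ∂m; let F : ℝ → Metric.sphere (0 : Literature.MathematicalPhysics.KineticTheory.V3) 1 → Literature.MathematicalPhysics.KineticTheory.V3 × Literature.MathematicalPhysics.KineticTheory.V3 → ℝ := fun ϑ ω p => Real.log (h ϑ p.1) + Real.log (h ϑ p.2) - Real.log (h ϑ (Literature.MathematicalPhysics.KineticTheory.collide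 ω p).1) - Real.log (h ϑ (Literature.MathematicalPhysics.KineticTheory.collide ω p).2); Filter.Tendsto (fun ϑ : ℝ => ∫⁻ p, ∫⁻ ω, ENNReal.ofReal (Literature.MathematicalPhysics.KineticTheory.hardSphereKernel (p.2, p.1) ω * (F ϑ ω p * (1 - Real.exp (-F ϑ ω p)))) ∂Literature.MathematicalPhysics.KineticTheory.sphereMeasure ∂(m.prod m)) (nhdsWithin 0 (Set.Ioi 0)) (nhds 0)) → (∃ u : Literature.MathematicalPhysics.KineticTheory.V3, m = MeasureTheory.Measure.dirac u) ∨ (∃ θ : ℝ, ∃ u : Literature.MathematicalPhysics.KineticTheory.V3, 0 < θ ∧ m = MeasureTheory.volume.withDensity (fun v => ENNReal.ofReal (Literature.Analysis.FluidPDE.localMaxwellian 1 θ u v)))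

/-- item stmt-AtomisticToContinuum-8229 · assembly · rank 1 · closed · moot by None · by planner
sources: BrezinaFeireisl2018, FeireislNovotny2012, Dafermos1979, CIP1994, Spohn1991
[assembly] OddFluxEfficiency → EvenFluxEnskog → RateFloor → LocalSecondLaw → DensityCap →
HydrodynamicLimit (compactness, free balance, parity rigidity, flux bookkeeping and complete-Euler
weak–strong uniqueness inside; supports ParitySplit, ParityRigidity, CollisionTightness,
EmpiricalEnskogIdentity, HsEosLowDensity consumed). -/
@[route_item "route-AtomisticToContinuum-JOddEnslaving"]
def Assembly : Prop :=
  OddFluxEfficiency → EvenFluxEnskog → RateFloor → LocalSecondLaw → DensityCap → Literature.MathematicalPhysics.KineticTheory.HydrodynamicLimit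

end Summit.AtomisticToContinuum.HydrodynamicLimit.Theses.JOddEnslaving
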